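import Mathlib
import Literature.NumberTheory.EllipticCurves.WZhang2014.KolyvaginNonvanishing
import Literature.NumberTheory.EllipticCurves.BSDSelmerCMPConverseRankOneProofs
import Literature.NumberTheory.EllipticCurves.IrreducibleModPQuadraticTwistProofs
import Literature.NumberTheory.EllipticCurves.NonEisensteinPrimeOfSurjective
import HarnessLib

/-!
# HeegnerPointsKolyvaginLevelOneStructure

Topic `Literature/NumberTheory/EllipticCurves`. Named literature fact(s) relocated by the gate from `Summits/BirchSwinnertonDyer/BirchSwinnertonDyer/Theorems/KolyvaginDepthDoorKNSupplyLevelOneStructure.lean`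
(accept-time relocation of `[cite]`d propositions written inline in a Summits proposal; human ruling 2026-08-15).
Sources: Kolyvagin1991MathAnn, WZhang2014.

* `Literature.NumberTheory.EllipticCurves.WZhang2014_lemma84_exists_minimal_kolyvaginClass_one_selmerCard`
-/

namespace Literature.NumberTheory.EllipticCurves

open scoped Classical
open Literature.NumberTheory.EllipticCurves Literature.NumberTheory.EllipticCurves.ModularForms

/-- **W. Zhang 2014, Lemma 8.4 (1) at the vanishing order of the mod-`p` Heegner-point Kolyvagin
system, with Theorem 9.1 (= Theorem 1.1) supplying its non-vanishing — case `N⁻ = 1`, for the newform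
of an elliptic curve.** Verbatim (Camb. J. Math. 2 (2014), §8.2, p. 236): *"Let `(g, p, K)` be as in
“Notations” satisfying Hypothesis ♥. Assume that `N⁻` has even number of factors. Let `κ = κ_g` be
the associated Kolyvagin system. Definition 8.3. • The vanishing order `ν` of `κ` is defined to be the
minimal `ν(n)` such that `c(n) ≠ 0` for some `n ∈ Λ`. If `κ = {0}`, we take `ν = ∞`. … Lemma 8.4.
Assume that `κ ≠ {0}`, i.e., the vanishing order `ν` of `κ` is finite. Then we have (1) The
`ε_ν`-eigenspace `Sel_p^{ε_ν}(A/K)` is of dimension `(ν + 1)`: `dim Sel_p^{ε_ν}(A/K) = ν + 1`, and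
`dim Sel_p^{−ε_ν}(A/K) ≤ ν`."* (`κ = {c(n) = c(n,1) ∈ H¹(K, V) : n ∈ Λ}`, (3.30) p. 215, the classes
with values in `V = A[𝔭]`, `k₀ = 𝔽_p` under (ix) p. 201; `Sel_p^±` the eigenspaces of the `p`-Selmer
group of `A/K` under complex conjugation), together with Theorem 9.1 (p. 240): *"Let `g` be a newform
of weight two of level `N` with trivial nebentypus, `𝔭` a prime ideal of `𝒪_g` above `p`, and `K` an
imaginary quadratic field of discriminant `D_K` such that `(D_K, N) = 1`. Assume • `N⁻` is square-free
with even number of prime factors. • `ρ̄_{g,𝔭₀}` … is surjective. • Hypothesis ♥ holds for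
`(g, 𝔭, K)`. • `p ∤ D_K N` and `p ≥ 5` is an ordinary prime. Then we have `κ = {c(n) ∈ H¹(K, V) :
n ∈ Λ} ≠ {0}`"* and (p. 243) *"Theorem 9.3 implies Theorem 1.1 since, by Lemma 5.1 (2), the item (3)
in Hypothesis ♥ for `(g, p, K)` holds automatically for the weight two newform `g` associated to
`E/ℚ` and `𝔭 = (p)`"* — so for `g = g_E` Hypothesis ♥ is Hypothesis ♠ of Thm. 1.1 (p. 195: *"(1)
`Ram(ρ̄_{E,p})` contains all primes `ℓ` such that `ℓ ∥ N⁺` and all primes `ℓ ∣ N⁻` such that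
`ℓ ≡ ±1 mod p`. (2) If `N` is not square-free, then `#Ram(ρ̄_{E,p}) ≥ 1`, and either `Ram(ρ̄_{E,p})`
contains a prime `ℓ ∥ N⁻` or there are at least two primes factors `ℓ ∥ N⁺`"*).
TRANSCRIPTION at `N⁻ = 1`, `g = g_E`, with EXACTLY the binders of the Thm. 1.1 record
`WZhang2014.thm11_exists_kolyvaginClass_one_ne_zero` (file `WZhang2014/KolyvaginNonvanishing`; `W` globally minimal, `5 ≤ p` good
ordinary, `ρ̄_{E,p}` onto, ♠(1) `hS1`: `p ∤ v_ℓ(Δ_min)` at every multiplicative `ℓ`, ♠(2) `hS2`, `K`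
imaginary quadratic with `p ∤ D_K`, `(D_K, N) = 1`, every `ℓ ∣ N` split) and its conclusion (a frame
`(Dt, β, ι)`, `n ∈ Λ` with `1 ≤ M(n)`, a Kolyvagin–Heegner datum `d` of conductor `n` with
`c_1(n) = d.kolyvaginClass _ 1 ≠ 0`) STRENGTHENED by: `ν(n) = #{ℓ ∣ n}` is minimal among the non-zero
level-one classes `c_1(n')` of the frame (Def. 8.3: `ν(n) = ν`, which exists as soon as `κ ≠ {0}`),
and Lemma 8.4 (1) read on the two eigenspaces in the currency of the tree's Kolyvagin record
`Kolyvagin1991_selmerCorank_of_kolyvaginClass_ne_zero` — for odd `p` the `+`-eigenspace of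
`Sel_p(E/K)` is `Sel_p(E/ℚ)` and the `−`-eigenspace is `Sel_p(E^{(D_K)}/ℚ)`, the `p`-Selmer group of
the quadratic twist (Kolyvagin, Math. Ann. 291 (1991) §2: *"The group `S^ν_{ℓ^n}` coincides … with
the Selmer group of level `ℓ^n` for `E^ν` over `ℚ`. Here `E^ν` is `E` if `(−1)^{ν+1}ε = 1`, and `E^ν`
is the form of `E` over `K` otherwise"*), dimensions as cardinalities (`dim = ν + 1` ↦
`# = p^{ν+1}`, `dim ≤ ν` ↦ `# ≤ p^ν`): EITHER `#Sel_p(E/ℚ) = p^{ν(n)+1} ∧ #Sel_p(E^{(D_K)}/ℚ) ≤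
p^{ν(n)}` OR the same with the two curves exchanged. Weaker than print, never stronger: which
eigenspace carries dimension `ν + 1` (the sign `ε_ν`) is forgotten; only `N⁻ = 1`; the frame is
existential (print: the fixed parametrisation of "Notations"/(3.20) on the curve `A` of the isogeny
class, p. 243 — under (ix) every isogeny of the class is prime to `p`, inducing `A[p] ≅ W[p]`,
`Sel_p(A) ≅ Sel_p(W)` and Heegner points to Heegner points, the reading of the Thm. 1.1 record).
-- TODO(general form): `N⁻` square-free with an even number of prime factors (Shimura curves); parts (2)–(3) of Lemma 8.4 (triangular basis, base locus).
Size XL (Thm. 9.1: level raising, Jacquet–Langlands, the Gross/BDP formula mod `p`, Skinner–Urban in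
rank `0`; Lemma 8.4: Kolyvagin's Chebotarev and global-duality arguments); no `_holds` expected;
nothing asserted — users take `(h : WZhang2014_lemma84_exists_minimal_kolyvaginClass_one_selmerCard)`.
[cite: WZhang2014, Def. 8.3 and Lemma 8.4 (1) (p. 236); Thm. 9.1 (p. 240); Thm. 9.3 and the sentence after it (p. 243); Thm. 1.1 with Hypothesis ♠ (p. 195); Notations (ix), (xii), (xv) (pp. 201–203); (3.30) (p. 215)]
[cite: Kolyvagin1991MathAnn, §2, the paragraph before Thm. 4 (the eigenspaces `S^ν_{ℓ^n}` as Selmer groups over `ℚ` of `E` and of its form over `K`)]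
[file NumberTheory/EllipticCurves/HeegnerPointsKolyvaginLevelOneStructure] -/
def WZhang2014_lemma84_exists_minimal_kolyvaginClass_one_selmerCard : Prop :=
  ∀ (W : WeierstrassCurve ℚ) [W.IsElliptic] [W.IsGloballyMinimal] (p : ℕ) [hp : Fact p.Prime],
    5 ≤ p → W.HasGoodReductionAtPrime p → ¬ (p : ℤ) ∣ W.frobeniusTrace p →
    W.HasSurjectiveModNGaloisRep p →
    -- Hypothesis ♠ (1) at `N⁻ = 1`: every `ℓ ∥ N` lies in `Ram(ρ̄_{E,p})`
    (∀ (ℓ : ℕ) [Fact ℓ.Prime], W.HasMultiplicativeReductionAtPrime ℓ →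
      ¬ p ∣ padicValInt ℓ W.minimalDiscriminantInt) →
    -- Hypothesis ♠ (2) at `N⁻ = 1`: `N` not square-free ⇒ `#Ram ≥ 1` and two primes `ℓ ∥ N`
    (¬ Squarefree (W.conductorNorm ℤ) →
      (∃ (ℓ : ℕ) (_ : Fact ℓ.Prime), W.HasMultiplicativeReductionAtPrime ℓ ∧
          ¬ p ∣ padicValInt ℓ W.minimalDiscriminantInt) ∧
        ∃ (ℓ₁ ℓ₂ : ℕ) (_ : Fact ℓ₁.Prime) (_ : Fact ℓ₂.Prime), ℓ₁ ≠ ℓ₂ ∧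
          W.HasMultiplicativeReductionAtPrime ℓ₁ ∧ W.HasMultiplicativeReductionAtPrime ℓ₂) →
    ∀ (K : Type) [Field K] [NumberField K], IsImaginaryQuadratic K →
      ¬ ((p : ℤ) ∣ NumberField.discr K) →
      IsCoprime (NumberField.discr K) ((W.conductorNorm ℤ : ℕ) : ℤ) →
      ∀ [NeZero (W.conductorNorm ℤ)], SatisfiesHeegnerHypothesis (W.conductorNorm ℤ) K →
      ∃ (Dt : ModularParametrizationData W (W.conductorNorm ℤ)) (β : ℤ) (ι : K →+* ℂ) (n : ℕ)
        (d : KolyvaginHeegnerData Dt β ι n),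
        KolyvaginDescent.KolSupp (Zhang2014.IsKolyvaginPrime (W.conductorNorm ℤ) W K p) n ∧
          (1 : ℕ∞) ≤ Zhang2014.levelIndex W p n ∧ d.kolyvaginClass hp.out 1 ≠ 0 ∧
          (∀ (n' : ℕ) (d' : KolyvaginHeegnerData Dt β ι n'),
            KolyvaginDescent.KolSupp (Zhang2014.IsKolyvaginPrime (W.conductorNorm ℤ) W K p) n' →
            d'.kolyvaginClass hp.out 1 ≠ 0 → n.primeFactors.card ≤ n'.primeFactors.card) ∧
          ((Nat.card (W.selmerGroup p) = p ^ (n.primeFactors.card + 1) ∧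
              Nat.card ((W.quadraticTwist (NumberField.discr K : ℚ)).selmerGroup p) ≤
                p ^ n.primeFactors.card) ∨
            (Nat.card ((W.quadraticTwist (NumberField.discr K : ℚ)).selmerGroup p) =
                p ^ (n.primeFactors.card + 1) ∧
              Nat.card (W.selmerGroup p) ≤ p ^ n.primeFactors.card))

end Literature.NumberTheory.EllipticCurves
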